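import Literature.Topology.FourManifolds.RadialStretch
import Literature.Topology.FourManifolds.SmoothEmbeddingComp
import HarnessLib

/-!
# Radial diffeomorphisms of Euclidean space onto a ball of prescribed radius, the identity on the unit ball

Parametrised version of `RadialStretch.lean` (which treats the radius `3`): for every `R > 1` a
`C^∞` diffeomorphism `Literature.Topology.FourManifolds.ballStretch R : E → B(0, R)` of a real inner
product space onto its open ball of radius `R` which is **the identity on the closed unit ball**,
packaged as the open partial homeomorphism `ballStretchPartialHomeomorph hR` (source `univ`,
target `ball 0 R`, `C^∞` with `C^∞` inverse). It is the radial map `t • u ↦ λ_R t • u` with the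
profile `λ_R t = t + χ ((t - 1)/δ) (R - δ/t - t)`, `δ = (R - 1)/3`, `χ = Real.smoothTransition`:
`λ_R t = t` for `t ≤ 1`, `λ_R t = R - δ/t` for `t ≥ 1 + δ`, `λ_R' > 0`, `λ_R < R`.

Use: to replace a smooth embedding `ι` of `ℝⁿ` by one with the same restriction to the unit ball
and with image the thin neighbourhood `ι (B(0, R))` of the image of the closed unit ball
(`ι ∘ ballStretch R`), and to globalise maps that are smooth only near the closed unit ball — both
needed when the pieces of a manifold cut along necks are re-embedded in the capped sides
(`Literature/Geometry/Riemannian/HamiltonSurgeryProgramme.lean`).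

## References

* M. W. Hirsch, *Differential Topology*, GTM 33, Springer (1976), Ch. 8 (standard isotopy and
  disc arguments; the profile is ad hoc). [Hirsch1976]
-/

open scoped ContDiff Topology Manifold
open Set Function Metric Real

noncomputable section

namespace Literature.Topology.FourManifolds

/-! ### §1 The profile `λ_R` -/

section Profile

variable {R : ℝ}

/-- The width `δ = (R - 1)/3` of the transition zone. [folklore] -/
def stretchWidth (R : ℝ) : ℝ := (R - 1) / 3

/-- `δ > 0` for `R > 1`. [folklore] -/
theorem stretchWidth_pos (hR : 1 < R) : 0 < stretchWidth R := by
  unfold stretchWidth; linarith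

/-- `R = 1 + 3 δ`. [folklore] -/
theorem eq_one_add_three_mul_stretchWidth (R : ℝ) : R = 1 + 3 * stretchWidth R := by
  unfold stretchWidth; ring

/-- The **profile** `λ_R t = t + χ ((t - 1)/δ) (R - δ/t - t)`, `δ = (R - 1)/3`: equal to `t` for
`t ≤ 1`, to `R - δ/t` for `t ≥ 1 + δ`, strictly increasing, with values `< R`. [folklore] -/
def stretchProfileR (R t : ℝ) : ℝ :=
  t + smoothTransition ((t - 1) / stretchWidth R) * (R - stretchWidth R / t - t)

/-- `λ_R t = t` for `t ≤ 1`. [folklore] -/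
theorem stretchProfileR_of_le_one (hR : 1 < R) {t : ℝ} (h : t ≤ 1) : stretchProfileR R t = t := by
  have hδ := stretchWidth_pos hR
  rw [stretchProfileR, smoothTransition.zero_of_nonpos (div_nonpos_of_nonpos_of_nonneg (by linarith) hδ.le),
    zero_mul, add_zero]

/-- `λ_R t = R - δ/t` for `t ≥ 1 + δ`. [folklore] -/
theorem stretchProfileR_of_ge (hR : 1 < R) {t : ℝ} (h : 1 + stretchWidth R ≤ t) :
    stretchProfileR R t = R - stretchWidth R / t := by
  have hδ := stretchWidth_pos hR
  have h1 : 1 ≤ (t - 1) / stretchWidth R := by rw [le_div_iff₀ hδ]; linarith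
  rw [stretchProfileR, smoothTransition.one_of_one_le h1, one_mul]; ring

/-- `λ_R 0 = 0`. [folklore] -/
theorem stretchProfileR_zero (hR : 1 < R) : stretchProfileR R 0 = 0 :=
  stretchProfileR_of_le_one hR zero_le_one

/-- `λ_R` as a convex combination: `λ_R t = (1 - χ) t + χ (R - δ/t)`. [folklore] -/
theorem stretchProfileR_eq_convex (t : ℝ) :
    stretchProfileR R t = (1 - smoothTransition ((t - 1) / stretchWidth R)) * t +
      smoothTransition ((t - 1) / stretchWidth R) * (R - stretchWidth R / t) := by
  rw [stretchProfileR]; ring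

/-- `λ_R t < R` for all `t`. [folklore] -/
theorem stretchProfileR_lt (hR : 1 < R) (t : ℝ) : stretchProfileR R t < R := by
  have hδ := stretchWidth_pos hR
  rcases le_or_gt t 1 with h1 | h1
  · rw [stretchProfileR_of_le_one hR h1]; linarith
  · have hχ0 := smoothTransition.nonneg ((t - 1) / stretchWidth R)
    have hχ1 := smoothTransition.le_one ((t - 1) / stretchWidth R)
    have htpos : 0 < t := by linarith
    have hinv : 0 < stretchWidth R / t := div_pos hδ htpos
    rcases lt_or_ge t R with h3 | h3
    · rw [stretchProfileR_eq_convex]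
      nlinarith [mul_nonneg (sub_nonneg.2 hχ1) (sub_nonneg.2 h3.le), mul_nonneg hχ0 hinv.le]
    · -- `t ≥ R ≥ 1 + δ`: then `χ = 1`
      have hge : 1 + stretchWidth R ≤ t := by
        have := eq_one_add_three_mul_stretchWidth R
        linarith
      rw [stretchProfileR_of_ge hR hge]
      linarith

/-- `0 < λ_R t` for `t > 0`. [folklore] -/
theorem stretchProfileR_pos (hR : 1 < R) {t : ℝ} (ht : 0 < t) : 0 < stretchProfileR R t := by
  have hδ := stretchWidth_pos hR
  rcases le_or_gt t 1 with h1 | h1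
  · rw [stretchProfileR_of_le_one hR h1]; exact ht
  · have hχ0 := smoothTransition.nonneg ((t - 1) / stretchWidth R)
    have hχ1 := smoothTransition.le_one ((t - 1) / stretchWidth R)
    have hinv : stretchWidth R / t < stretchWidth R := by
      rw [div_lt_iff₀ (by linarith)]; nlinarith
    have hR' : R - stretchWidth R > 1 := by
      have := eq_one_add_three_mul_stretchWidth R
      linarith
    rw [stretchProfileR_eq_convex]
    nlinarith [mul_nonneg hχ0 (by linarith : (0 : ℝ) ≤ R - stretchWidth R / t - 1)]

/-- `0 ≤ λ_R t` for `t ≥ 0`. [folklore] -/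
theorem stretchProfileR_nonneg (hR : 1 < R) {t : ℝ} (ht : 0 ≤ t) : 0 ≤ stretchProfileR R t := by
  rcases ht.eq_or_lt with h | h
  · rw [← h, stretchProfileR_zero hR]
  · exact (stretchProfileR_pos hR h).le

/-- `λ_R` is smooth at every `t ≠ 0`. [folklore] -/
theorem contDiffAt_stretchProfileR_of_ne {t : ℝ} (ht : t ≠ 0) :
    ContDiffAt ℝ ∞ (stretchProfileR R) t := by
  have h1 : ContDiffAt ℝ ∞ (fun t : ℝ => smoothTransition ((t - 1) / stretchWidth R)) t :=
    smoothTransition.contDiff.contDiffAt.comp t ((contDiffAt_id.sub contDiffAt_const).div_const _)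
  have h2 : ContDiffAt ℝ ∞ (fun t : ℝ => R - stretchWidth R / t - t) t := by
    have : (fun t : ℝ => R - stretchWidth R / t - t) = fun t => R - stretchWidth R * t⁻¹ - t := by
      funext s; rw [div_eq_mul_inv]
    rw [this]
    exact (contDiffAt_const.sub (contDiffAt_const.mul (contDiffAt_inv ℝ ht))).sub contDiffAt_id
  exact contDiffAt_id.add (h1.mul h2)

/-- `λ_R` is smooth (near `t < 1` it is the identity). [folklore] -/
theorem contDiff_stretchProfileR (hR : 1 < R) : ContDiff ℝ ∞ (stretchProfileR R) := by
  rw [contDiff_iff_contDiffAt]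
  intro t
  rcases eq_or_ne t 0 with rfl | ht
  · have hev : stretchProfileR R =ᶠ[𝓝 (0 : ℝ)] id :=
      Filter.eventuallyEq_of_mem (Iio_mem_nhds (by norm_num : (0 : ℝ) < 1))
        fun s hs => stretchProfileR_of_le_one hR (le_of_lt hs)
    exact contDiffAt_id.congr_of_eventuallyEq hev
  · exact contDiffAt_stretchProfileR_of_ne ht

/-- `λ_R` is differentiable. [folklore] -/
theorem differentiable_stretchProfileR (hR : 1 < R) : Differentiable ℝ (stretchProfileR R) :=
  (contDiff_stretchProfileR hR).differentiable (by simp)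

/-- The cut-off factor `t ↦ χ ((t - 1)/δ)` has derivative `χ'((t - 1)/δ) / δ`. [folklore] -/
theorem hasDerivAt_smoothTransition_scaled (t : ℝ) :
    HasDerivAt (fun t : ℝ => smoothTransition ((t - 1) / stretchWidth R))
      (deriv smoothTransition ((t - 1) / stretchWidth R) / stretchWidth R) t := by
  have hd : Differentiable ℝ smoothTransition :=
    (smoothTransition.contDiff (n := 1)).differentiable one_ne_zero
  have h := (hd ((t - 1) / stretchWidth R)).hasDerivAt.comp t
    (((hasDerivAt_id t).sub_const 1).div_const (stretchWidth R))
  rw [one_div, ← div_eq_mul_inv] at h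
  exact h

/-- **The derivative of `λ_R`** at `t ≠ 0`:
`λ_R' t = 1 + χ'((t-1)/δ)/δ · (R - δ/t - t) + χ ((t-1)/δ) (δ/t² - 1)`. [folklore] -/
theorem hasDerivAt_stretchProfileR {t : ℝ} (ht : t ≠ 0) :
    HasDerivAt (stretchProfileR R)
      (1 + (deriv smoothTransition ((t - 1) / stretchWidth R) / stretchWidth R *
        (R - stretchWidth R / t - t) +
        smoothTransition ((t - 1) / stretchWidth R) * (stretchWidth R / t ^ 2 - 1))) t := by
  have h1 := hasDerivAt_smoothTransition_scaled (R := R) t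
  have h2 : HasDerivAt (fun t : ℝ => R - stretchWidth R / t - t) (stretchWidth R / t ^ 2 - 1) t := by
    have hi : HasDerivAt (fun t : ℝ => stretchWidth R / t) (-(stretchWidth R / t ^ 2)) t := by
      have h0 := (hasDerivAt_inv ht).const_mul (stretchWidth R)
      have heq : (fun t : ℝ => stretchWidth R * t⁻¹) = fun t => stretchWidth R / t := by
        funext s; rw [div_eq_mul_inv]
      rw [heq] at h0
      have hval : stretchWidth R * -(t ^ 2)⁻¹ = -(stretchWidth R / t ^ 2) := by
        rw [div_eq_mul_inv, mul_neg]
      rw [hval] at h0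
      exact h0
    have h3 := ((hasDerivAt_const t R).sub hi).sub (hasDerivAt_id t)
    have hval : 0 - -(stretchWidth R / t ^ 2) - 1 = stretchWidth R / t ^ 2 - 1 := by ring
    rw [hval] at h3
    exact h3
  exact (hasDerivAt_id' t).fun_add (h1.fun_mul h2)

/-- **`λ_R' > 0`.** For `t < 1` the profile is the identity near `t`; for `t ≥ 1` the derivative
is `(1 - χ) + χ δ/t² + χ'/δ · (R - δ/t - t)` with `χ' ≥ 0` and `R - δ/t - t ≥ 0` as long as
`χ' ≠ 0` (i.e. `t ≤ 1 + δ`; indeed up to `1 + 2δ`). [folklore] -/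
theorem deriv_stretchProfileR_pos (hR : 1 < R) (t : ℝ) : 0 < deriv (stretchProfileR R) t := by
  have hδ := stretchWidth_pos hR
  rcases lt_or_ge t 1 with h1 | h1
  · have hev : stretchProfileR R =ᶠ[𝓝 t] id :=
      Filter.eventuallyEq_of_mem (Iio_mem_nhds h1) fun s hs => stretchProfileR_of_le_one hR (le_of_lt hs)
    rw [hev.deriv_eq, deriv_id]
    exact one_pos
  · have ht : t ≠ 0 := by rintro rfl; linarith
    rw [(hasDerivAt_stretchProfileR ht).deriv]
    have hχ0 := smoothTransition.nonneg ((t - 1) / stretchWidth R)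
    have hχ1 := smoothTransition.le_one ((t - 1) / stretchWidth R)
    have hd := deriv_smoothTransition_nonneg ((t - 1) / stretchWidth R)
    have ht2 : 0 < stretchWidth R / t ^ 2 := by positivity
    -- the cut-off term is nonnegative
    have hcut : 0 ≤ deriv smoothTransition ((t - 1) / stretchWidth R) / stretchWidth R *
        (R - stretchWidth R / t - t) := by
      rcases le_or_gt t (1 + 2 * stretchWidth R) with h52 | h52
      · refine mul_nonneg (div_nonneg hd hδ.le) ?_
        have htpos : 0 < t := by linarith
        have hRδ := eq_one_add_three_mul_stretchWidth R
        have hkey : 0 ≤ R * t - stretchWidth R - t ^ 2 := by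
          have hu0 : 0 ≤ t - 1 := by linarith
          have hu1 : 0 ≤ 1 + 2 * stretchWidth R - t := by linarith
          nlinarith [mul_nonneg hu0 (by linarith : (0 : ℝ) ≤ 3 * stretchWidth R - (t - 1)),
            mul_nonneg hu0 hu1]
        have : R - stretchWidth R / t - t = (R * t - stretchWidth R - t ^ 2) / t := by
          field_simp
        rw [this]; exact div_nonneg hkey htpos.le
      · rw [deriv_smoothTransition_of_one_lt (by rw [lt_div_iff₀ hδ]; linarith), zero_div, zero_mul]
    -- the blend term is positive
    have hblend : 0 < 1 + smoothTransition ((t - 1) / stretchWidth R) * (stretchWidth R / t ^ 2 - 1) := by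
      have : 1 + smoothTransition ((t - 1) / stretchWidth R) * (stretchWidth R / t ^ 2 - 1) =
          (1 - smoothTransition ((t - 1) / stretchWidth R)) +
            smoothTransition ((t - 1) / stretchWidth R) * (stretchWidth R / t ^ 2) := by ring
      rw [this]
      rcases hχ1.lt_or_eq with hlt | heq
      · exact add_pos_of_pos_of_nonneg (by linarith) (mul_nonneg hχ0 ht2.le)
      · rw [heq]; linarith
    linarith

/-- `λ_R` is strictly increasing. [folklore] -/
theorem strictMono_stretchProfileR (hR : 1 < R) : StrictMono (stretchProfileR R) :=
  strictMono_of_deriv_pos (deriv_stretchProfileR_pos hR)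

/-- `λ_R` is injective. [folklore] -/
theorem injective_stretchProfileR (hR : 1 < R) : Injective (stretchProfileR R) :=
  (strictMono_stretchProfileR hR).injective

/-- `λ_R` maps `[0, ∞)` onto `[0, R)`. [folklore] -/
theorem exists_stretchProfileR_eq (hR : 1 < R) {s : ℝ} (hs0 : 0 ≤ s) (hsR : s < R) :
    ∃ t, 0 ≤ t ∧ stretchProfileR R t = s := by
  have hδ := stretchWidth_pos hR
  set T : ℝ := max (1 + stretchWidth R) (stretchWidth R / (R - s)) + 1 with hT
  have hT2 : 1 + stretchWidth R ≤ T := by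
    rw [hT]; linarith [le_max_left (1 + stretchWidth R) (stretchWidth R / (R - s))]
  have hRs : 0 < R - s := by linarith
  have hTs : s ≤ stretchProfileR R T := by
    rw [stretchProfileR_of_ge hR hT2]
    have h1 : stretchWidth R / (R - s) < T := by
      rw [hT]; linarith [le_max_right (1 + stretchWidth R) (stretchWidth R / (R - s))]
    have hTpos : 0 < T := by linarith
    have : stretchWidth R / T < R - s := by
      rw [div_lt_iff₀ hTpos]
      rw [div_lt_iff₀ hRs] at h1
      linarith
    linarith
  have hc : ContinuousOn (stretchProfileR R) (Icc 0 T) :=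
    (contDiff_stretchProfileR hR).continuous.continuousOn
  obtain ⟨t, ht, hts⟩ := intermediate_value_Icc (by linarith : (0 : ℝ) ≤ T) hc
    ⟨by rw [stretchProfileR_zero hR]; exact hs0, hTs⟩
  exact ⟨t, ht.1, hts⟩

/-- The inverse profile `λ_R⁻¹` (a global left inverse of the injective `λ_R`). [folklore] -/
def stretchProfileRInv (R : ℝ) : ℝ → ℝ := invFun (stretchProfileR R)

/-- `λ_R⁻¹ (λ_R t) = t`. [folklore] -/
theorem stretchProfileRInv_stretchProfileR (hR : 1 < R) (t : ℝ) :
    stretchProfileRInv R (stretchProfileR R t) = t :=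
  leftInverse_invFun (injective_stretchProfileR hR) t

/-- `λ_R⁻¹ s = s` for `s ≤ 1`. [folklore] -/
theorem stretchProfileRInv_of_le_one (hR : 1 < R) {s : ℝ} (h : s ≤ 1) : stretchProfileRInv R s = s := by
  conv_lhs => rw [← stretchProfileR_of_le_one hR h]
  exact stretchProfileRInv_stretchProfileR hR s

/-- `λ_R⁻¹` is smooth at `λ_R t`. [folklore] -/
theorem contDiffAt_stretchProfileRInv (hR : 1 < R) (t : ℝ) :
    ContDiffAt ℝ ∞ (stretchProfileRInv R) (stretchProfileR R t) :=
  contDiffAt_leftInverse_of_hasDerivAt (contDiff_stretchProfileR hR).contDiffAt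
    (differentiable_stretchProfileR hR t).hasDerivAt (deriv_stretchProfileR_pos hR t).ne' (by simp)
    (leftInverse_invFun (injective_stretchProfileR hR))

end Profile

/-! ### §2 The stretch diffeomorphism `E ≅ B(0, R)` -/

section Stretch

variable {E : Type*} [NormedAddCommGroup E] [InnerProductSpace ℝ E] {R : ℝ}

/-- The **ball stretch** `t • u ↦ λ_R t • u`: a diffeomorphism of `E` onto `B(0, R)`, the identity
on the closed unit ball. [folklore] -/
def ballStretch (R : ℝ) : E → E := radialMap (stretchProfileR R)

/-- The inverse of the ball stretch (on `B(0, R)`). [folklore] -/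
def ballStretchInv (R : ℝ) : E → E := radialMap (stretchProfileRInv R)

/-- `ballStretch R 0 = 0`. [folklore] -/
theorem ballStretch_zero (R : ℝ) : ballStretch R (0 : E) = 0 := radialMap_zero _

/-- `‖ballStretch R z‖ = λ_R ‖z‖`. [folklore] -/
theorem norm_ballStretch (hR : 1 < R) (z : E) : ‖ballStretch R z‖ = stretchProfileR R ‖z‖ := by
  rcases eq_or_ne z 0 with rfl | hz
  · rw [ballStretch_zero, norm_zero, stretchProfileR_zero hR]
  · rw [ballStretch, norm_radialMap _ hz, abs_of_pos (stretchProfileR_pos hR (norm_pos_iff.2 hz))]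

/-- The ball stretch maps into `B(0, R)`. [folklore] -/
theorem norm_ballStretch_lt (hR : 1 < R) (z : E) : ‖ballStretch R z‖ < R := by
  rw [norm_ballStretch hR]; exact stretchProfileR_lt hR _

/-- **The ball stretch is the identity on the closed unit ball.** [folklore] -/
theorem ballStretch_eq_self (hR : 1 < R) {z : E} (hz : ‖z‖ ≤ 1) : ballStretch R z = z :=
  radialMap_eq_self _ (stretchProfileR_of_le_one hR hz)

/-- The ball stretch is smooth. [folklore] -/
theorem contDiff_ballStretch (hR : 1 < R) : ContDiff ℝ ∞ (ballStretch R : E → E) := by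
  rw [contDiff_iff_contDiffAt]
  intro z
  rcases eq_or_ne z 0 with rfl | hz
  · have hev : (ballStretch R : E → E) =ᶠ[𝓝 0] id :=
      Filter.eventuallyEq_of_mem (ball_mem_nhds (0 : E) one_pos)
        fun w hw => ballStretch_eq_self hR (le_of_lt (by simpa using hw))
    exact contDiffAt_id.congr_of_eventuallyEq hev
  · exact contDiffAt_radialMap hz (contDiff_stretchProfileR hR).contDiffAt

/-- The ball stretch is continuous. [folklore] -/
theorem continuous_ballStretch (hR : 1 < R) : Continuous (ballStretch R : E → E) :=
  (contDiff_ballStretch hR).continuous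

/-- `ballStretch⁻¹ (ballStretch z) = z`. [folklore] -/
theorem ballStretchInv_ballStretch (hR : 1 < R) (z : E) : ballStretchInv R (ballStretch R z) = z := by
  rcases eq_or_ne z 0 with rfl | hz
  · rw [ballStretch_zero, ballStretchInv, radialMap_zero]
  · rw [ballStretchInv, ballStretch,
      radialMap_radialMap _ _ hz (stretchProfileR_pos hR (norm_pos_iff.2 hz)),
      stretchProfileRInv_stretchProfileR hR, mul_inv_cancel₀ (norm_ne_zero_iff.2 hz), one_smul]

/-- The ball stretch is injective. [folklore] -/
theorem injective_ballStretch (hR : 1 < R) : Injective (ballStretch R : E → E) :=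
  LeftInverse.injective (ballStretchInv_ballStretch hR)

/-- `ballStretch (ballStretch⁻¹ y) = y` for `‖y‖ < R`. [folklore] -/
theorem ballStretch_ballStretchInv (hR : 1 < R) {y : E} (hy : ‖y‖ < R) :
    ballStretch R (ballStretchInv R y) = y := by
  rcases eq_or_ne y 0 with rfl | hy0
  · rw [ballStretchInv, radialMap_zero, ballStretch_zero]
  · obtain ⟨t, ht0, hty⟩ := exists_stretchProfileR_eq hR (norm_nonneg y) hy
    have htpos : 0 < t := by
      rcases ht0.eq_or_lt with h | h
      · exfalso; rw [← h, stretchProfileR_zero hR] at hty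
        exact hy0 (norm_eq_zero.1 hty.symm)
      · exact h
    have hinv : stretchProfileRInv R ‖y‖ = t := by rw [← hty, stretchProfileRInv_stretchProfileR hR]
    rw [ballStretch, ballStretchInv, radialMap_radialMap _ _ hy0 (by rw [hinv]; exact htpos), hinv,
      hty, mul_inv_cancel₀ (norm_ne_zero_iff.2 hy0), one_smul]

/-- The image of the ball stretch is the open ball `B(0, R)`. [folklore] -/
theorem range_ballStretch (hR : 1 < R) : range (ballStretch R : E → E) = ball 0 R := by
  apply Subset.antisymm
  · rintro _ ⟨z, rfl⟩
    simpa using norm_ballStretch_lt hR z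
  · intro y hy
    exact ⟨ballStretchInv R y, ballStretch_ballStretchInv hR (by simpa using hy)⟩

/-- The image of a set under a composite with the ball stretch lies in the image of `B(0, R)`.
[folklore] -/
theorem range_comp_ballStretch (hR : 1 < R) {α : Type*} (f : E → α) :
    range (f ∘ ballStretch R) = f '' ball 0 R := by
  rw [range_comp, range_ballStretch hR]

/-- **The inverse ball stretch is the identity on the closed unit ball.** [folklore] -/
theorem ballStretchInv_eq_self (hR : 1 < R) {y : E} (hy : ‖y‖ ≤ 1) : ballStretchInv R y = y :=
  radialMap_eq_self _ (stretchProfileRInv_of_le_one hR hy)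

/-- The inverse ball stretch is smooth at the points of `B(0, R)`. [folklore] -/
theorem contDiffAt_ballStretchInv (hR : 1 < R) {y : E} (hy : ‖y‖ < R) :
    ContDiffAt ℝ ∞ (ballStretchInv R : E → E) y := by
  rcases eq_or_ne y 0 with rfl | hy0
  · have hev : (ballStretchInv R : E → E) =ᶠ[𝓝 0] id :=
      Filter.eventuallyEq_of_mem (ball_mem_nhds (0 : E) one_pos)
        fun w hw => ballStretchInv_eq_self hR (le_of_lt (by simpa using hw))
    exact contDiffAt_id.congr_of_eventuallyEq hev
  · obtain ⟨t, -, hty⟩ := exists_stretchProfileR_eq hR (norm_nonneg y) hy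
    refine contDiffAt_radialMap hy0 ?_
    rw [← hty]
    exact contDiffAt_stretchProfileRInv hR t

/-- The inverse ball stretch is smooth on `B(0, R)`. [folklore] -/
theorem contDiffOn_ballStretchInv (hR : 1 < R) : ContDiffOn ℝ ∞ (ballStretchInv R : E → E) (ball 0 R) :=
  fun _ hy => (contDiffAt_ballStretchInv hR (by simpa using hy)).contDiffWithinAt

/-- **The ball stretch as a partial homeomorphism `E ≃ B(0, R)`** with source `univ`, smooth with
smooth inverse, the identity on the closed unit ball. [folklore] -/
def ballStretchPartialHomeomorph (hR : 1 < R) : OpenPartialHomeomorph E E where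
  toFun := ballStretch R
  invFun := ballStretchInv R
  source := univ
  target := ball 0 R
  map_source' z _ := by simpa using norm_ballStretch_lt hR z
  map_target' _ _ := mem_univ _
  left_inv' z _ := ballStretchInv_ballStretch hR z
  right_inv' _ hy := ballStretch_ballStretchInv hR (by simpa using hy)
  open_source := isOpen_univ
  open_target := isOpen_ball
  continuousOn_toFun := (continuous_ballStretch hR).continuousOn
  continuousOn_invFun := (contDiffOn_ballStretchInv hR).continuousOn

/-- `ballStretchPartialHomeomorph` acts as the ball stretch. [folklore] -/
@[simp] theorem ballStretchPartialHomeomorph_coe (hR : 1 < R) :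
    ⇑(ballStretchPartialHomeomorph (E := E) hR) = ballStretch R := rfl

/-- Its inverse acts as the inverse ball stretch. [folklore] -/
@[simp] theorem ballStretchPartialHomeomorph_symm_coe (hR : 1 < R) :
    ⇑(ballStretchPartialHomeomorph (E := E) hR).symm = ballStretchInv R := rfl

/-- Its source is everything. [folklore] -/
@[simp] theorem ballStretchPartialHomeomorph_source (hR : 1 < R) :
    (ballStretchPartialHomeomorph (E := E) hR).source = univ := rfl

/-- Its target is `B(0, R)`. [folklore] -/
@[simp] theorem ballStretchPartialHomeomorph_target (hR : 1 < R) :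
    (ballStretchPartialHomeomorph (E := E) hR).target = ball 0 R := rfl

/-- The ball stretch is `C^∞` on its source and its inverse on its target. [folklore] -/
theorem contDiffOn_ballStretchPartialHomeomorph (hR : 1 < R) :
    ContDiffOn ℝ ∞ (ballStretchPartialHomeomorph (E := E) hR)
      (ballStretchPartialHomeomorph (E := E) hR).source ∧
    ContDiffOn ℝ ∞ (ballStretchPartialHomeomorph (E := E) hR).symm
      (ballStretchPartialHomeomorph (E := E) hR).target :=
  ⟨(contDiff_ballStretch hR).contDiffOn, contDiffOn_ballStretchInv hR⟩

/-- **The ball stretch is a local diffeomorphism everywhere**: it has the smooth two-sided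
inverse `ballStretchInv` near every point, so its derivative is invertible. Recorded as the
statement that the Fréchet derivative is injective, the form consumed by
`isSmoothEmbedding_comp_coe_closedBall_of_injective_mfderiv`. [folklore] -/
theorem injective_fderiv_ballStretch (hR : 1 < R) (z : E) : Injective (fderiv ℝ (ballStretch R) z) := by
  have hg : HasFDerivAt (ballStretchInv R) (fderiv ℝ (ballStretchInv R) (ballStretch R z)) (ballStretch R z) :=
    ((contDiffAt_ballStretchInv hR (norm_ballStretch_lt hR z)).differentiableAt (by simp)).hasFDerivAt
  have hf : HasFDerivAt (ballStretch R) (fderiv ℝ (ballStretch R) z) z :=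
    (((contDiff_ballStretch hR).contDiffAt (x := z)).differentiableAt (by simp)).hasFDerivAt
  have hcomp := hg.comp z hf
  have hid : HasFDerivAt (ballStretchInv R ∘ ballStretch R) (ContinuousLinearMap.id ℝ E) z := by
    have : (ballStretchInv R ∘ ballStretch R : E → E) = id := funext (ballStretchInv_ballStretch hR)
    rw [this]
    exact hasFDerivAt_id z
  have heq := hcomp.unique hid
  intro v w hvw
  have := congrArg (fderiv ℝ (ballStretchInv R) (ballStretch R z)) hvw
  rw [← ContinuousLinearMap.comp_apply, ← ContinuousLinearMap.comp_apply, heq] at this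
  simpa using this

/-- The ball stretch is `C^∞` on its source and its inverse on its target, manifold form
(model `𝓘(ℝ, E)`), as consumed by `Manifold.IsSmoothEmbedding.comp_openPartialHomeomorph`.
[folklore] -/
theorem contMDiffOn_ballStretchPartialHomeomorph (hR : 1 < R) :
    ContMDiffOn 𝓘(ℝ, E) 𝓘(ℝ, E) ∞ (ballStretchPartialHomeomorph (E := E) hR)
      (ballStretchPartialHomeomorph (E := E) hR).source ∧
    ContMDiffOn 𝓘(ℝ, E) 𝓘(ℝ, E) ∞ (ballStretchPartialHomeomorph (E := E) hR).symm
      (ballStretchPartialHomeomorph (E := E) hR).target := by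
  refine ⟨?_, ?_⟩
  · rw [contMDiffOn_iff_contDiffOn]
    exact (contDiff_ballStretch hR).contDiffOn
  · rw [contMDiffOn_iff_contDiffOn]
    exact contDiffOn_ballStretchInv hR

/-- **Thinning a smooth embedding of Euclidean space**: if `ι : E → M` is a `C^∞` embedding into a
manifold, so is `ι ∘ ballStretch R` (`R > 1`), which agrees with `ι` on the closed unit ball and
has range `ι '' B(0, R)` (`Manifold.IsSmoothEmbedding.comp_openPartialHomeomorph`,
`SmoothEmbeddingComp.lean`). [folklore] -/
theorem _root_.Manifold.IsSmoothEmbedding.comp_ballStretch {EM : Type*} [NormedAddCommGroup EM]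
    [NormedSpace ℝ EM] {HM : Type*} [TopologicalSpace HM] {IM : ModelWithCorners ℝ EM HM}
    {M : Type*} [TopologicalSpace M] [ChartedSpace HM M] {ι : E → M}
    (hι : Manifold.IsSmoothEmbedding 𝓘(ℝ, E) IM ∞ ι) (hR : 1 < R) :
    Manifold.IsSmoothEmbedding 𝓘(ℝ, E) IM ∞ (ι ∘ ballStretch R) :=
  hι.comp_openPartialHomeomorph (ballStretchPartialHomeomorph hR) rfl
    (contMDiffOn_ballStretchPartialHomeomorph hR).1 (contMDiffOn_ballStretchPartialHomeomorph hR).2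

/-- The thinned embedding has range `ι '' B(0, R)`. [folklore] -/
theorem range_comp_ballStretch' (hR : 1 < R) {α : Type*} (ι : E → α) :
    range (ι ∘ ballStretch R) = ι '' ball 0 R :=
  range_comp_ballStretch hR ι

/-- The thinned embedding agrees with `ι` on the closed unit ball. [folklore] -/
theorem comp_ballStretch_apply_of_norm_le (hR : 1 < R) {α : Type*} (ι : E → α) {z : E} (hz : ‖z‖ ≤ 1) :
    (ι ∘ ballStretch R) z = ι z := by
  rw [comp_apply, ballStretch_eq_self hR hz]

end Stretch

end Literature.Topology.FourManifolds

end
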